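import Literature.Geometry.Riemannian.SphericalZonalKernelSeries
import Mathlib.Analysis.Calculus.SmoothSeries
import Mathlib.Analysis.Calculus.Deriv.MeanValue
import Mathlib.Analysis.Calculus.Deriv.Pow
import Mathlib.Analysis.Calculus.Deriv.Mul
import HarnessLib

/-!
# The zonal heat-kernel series of `S⁴`: term-wise derivative and the reduction of its
# monotonicity to the non-negativity of the `S⁶` series

Sequel of `SphericalZonalKernelSeries.lean` (summability of the typed Gegenbauer heat series
`zonal τ s = ∑_k e^{-k(k+3)τ} (2k+3)/3 · C_k^{(3/2)}(s)` of
`Literature.Geometry.Riemannian.SphericalCylinderEntropy` and of its `S⁶` analogue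
`zonalSix τ s = ∑_j e^{-j(j+5)τ} (2j+5)/5 · C_j^{(5/2)}(s)` for every `τ > 0`).  Here:

* `hasDerivAt_gegen_succ` — the classical derivative formula
  `d/ds C_{j+1}^{(3/2)}(s) = 3 C_j^{(5/2)}(s)` (AAR §6.4: `d/dx C_n^λ = 2λ C_{n-1}^{λ+1}`), as an
  identity of the explicit finite sums `gegen (j+1)` and `gegenSix j` (ascending-Pochhammer
  bookkeeping `(3/2)_{m+1} = (3/2) (5/2)_m`; for odd `j` the top term of `gegen (j+1)` is constant);
* `hasDerivAt_zonal` — **term-wise differentiation** (`hasDerivAt_tsum_of_isPreconnected` on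
  `Ioo (-R) R` with the uniform majorant of the previous file):
  `∂_s zonal τ s = 5 e^{-4τ} · zonalSix τ s` for every `τ > 0` and every real `s`
  (`3 · wt (j+1) τ = 5 e^{-4τ} wtSix j τ` since `(j+1)(j+4) = j(j+5) + 4`);
* `differentiable_zonal`, `continuous_zonal`, `deriv_zonal`, `continuous_zonalSix`;
* `monotoneOn_zonal_of_zonalSix_nonneg` — **the reduction**: if `zonalSix τ ≥ 0` on `[-1, 1]`
  (positivity of the heat kernel of the round `S⁶`, Davies Ch. 5), then `zonal τ` is monotone on
  `[-1, 1]`, i.e. the heat kernel of the round `S⁴` is a non-increasing function of the geodesic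
  distance (the lemma of Cheeger–Yau 1981 behind their heat-kernel comparison theorem), by
  `monotoneOn_of_deriv_nonneg`.

Everything here is proved; no named facts are introduced.  The non-negativity of `zonalSix` itself
(positivity of the `S⁶` heat kernel) is proved in the sequels `SphericalZonalSixDuality.lean`,
`SphericalZonalSixPositivity.lean` (energy method for the ultraspherical polynomial heat flow +
duality + polynomial approximation), which conclude `monotoneOn_zonal` unconditionally.

## References
* G. E. Andrews, R. Askey, R. Roy, *Special Functions*, CUP 1999, §6.4 ((6.4.11) and the derivative
  formula of the ultraspherical polynomials).
* E. B. Davies, *Heat Kernels and Spectral Theory*, CUP 1989, Ch. 5.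
* J. Cheeger, S.-T. Yau, *A lower bound for the heat kernel*, Comm. Pure Appl. Math. 34 (1981),
  465–480.
-/

noncomputable section

open scoped BigOperators Topology Nat
open Filter Set Literature.Geometry.Riemannian.SphericalCylinderEntropy

namespace Literature.Geometry.Riemannian.SphericalZonalKernelSeries

/-! ### The derivative of the Gegenbauer sums: `d/ds C_{j+1}^{(3/2)} = 3 C_j^{(5/2)}` -/

/-- `C_0^{(3/2)}` is constant. [folklore] -/
theorem hasDerivAt_gegen_zero (s : ℝ) : HasDerivAt (gegen 0) 0 s := by
  have h : gegen 0 = fun _ : ℝ => (1 : ℝ) := funext gegen_zero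
  rw [h]
  exact hasDerivAt_const s 1

/-- The summand identity behind `d/ds C_{j+1}^{(3/2)} = 3 C_j^{(5/2)}`: for `2l ≤ j`,
`(-1)^l (3/2)_{j+1-l} / (l! (j+1-2l)!) · (j+1-2l) (2s)^{j-2l} · 2 = 3 · (-1)^l (5/2)_{j-l}/(l!(j-2l)!) (2s)^{j-2l}`
(`(3/2)_{m+1} = (3/2) (5/2)_m`). [folklore] -/
theorem gegen_deriv_summand (j l : ℕ) (hl : 2 * l ≤ j) (s : ℝ) :
    (-1 : ℝ) ^ l * (∏ i ∈ Finset.range (j + 1 - l), ((3 : ℝ) / 2 + (i : ℝ))) /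
        (((l.factorial : ℕ) : ℝ) * (((j + 1 - 2 * l).factorial : ℕ) : ℝ)) *
      (((j + 1 - 2 * l : ℕ) : ℝ) * (2 * s) ^ (j + 1 - 2 * l - 1) * 2) =
    3 * ((-1 : ℝ) ^ l * (∏ i ∈ Finset.range (j - l), ((5 : ℝ) / 2 + (i : ℝ))) /
        (((l.factorial : ℕ) : ℝ) * (((j - 2 * l).factorial : ℕ) : ℝ)) * (2 * s) ^ (j - 2 * l)) := by
  have e1 : j + 1 - l = (j - l) + 1 := by omega
  have e2 : j + 1 - 2 * l = (j - 2 * l) + 1 := by omega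
  have e3 : j + 1 - 2 * l - 1 = j - 2 * l := by omega
  rw [e3, e2, e1, Finset.prod_range_succ', Nat.factorial_succ]
  have hP : ∏ i ∈ Finset.range (j - l), ((3 : ℝ) / 2 + ((i + 1 : ℕ) : ℝ)) =
      ∏ i ∈ Finset.range (j - l), ((5 : ℝ) / 2 + (i : ℝ)) :=
    Finset.prod_congr rfl fun i _ => by push_cast; ring
  rw [hP]
  have hl0 : ((l.factorial : ℕ) : ℝ) ≠ 0 := by positivity
  have hn0 : (((j - 2 * l).factorial : ℕ) : ℝ) ≠ 0 := by positivity
  have hs0 : ((j - 2 * l : ℕ) : ℝ) + 1 ≠ 0 := by positivity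
  push_cast
  field_simp
  ring

/-- **`d/ds C_{j+1}^{(3/2)}(s) = 3 C_j^{(5/2)}(s)`** (`d/dx C_n^λ = 2λ C_{n-1}^{λ+1}` with `λ = 3/2`),
for the explicit finite sums `gegen` and `gegenSix`.
[cite: AndrewsAskeyRoy1999, §6.4 (derivative of ultraspherical polynomials)] -/
theorem hasDerivAt_gegen_succ (j : ℕ) (s : ℝ) :
    HasDerivAt (gegen (j + 1)) (3 * gegenSix j s) s := by
  have h2s : HasDerivAt (fun x : ℝ => 2 * x) 2 s := by
    simpa using (hasDerivAt_id s).const_mul (2 : ℝ)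
  -- term-wise derivative of the finite sum
  have hsum : HasDerivAt (gegen (j + 1))
      (∑ l ∈ Finset.range ((j + 1) / 2 + 1), (-1 : ℝ) ^ l *
        (∏ i ∈ Finset.range (j + 1 - l), ((3 : ℝ) / 2 + (i : ℝ))) /
          (((l.factorial : ℕ) : ℝ) * (((j + 1 - 2 * l).factorial : ℕ) : ℝ)) *
        (((j + 1 - 2 * l : ℕ) : ℝ) * (2 * s) ^ (j + 1 - 2 * l - 1) * 2)) s := by
    refine HasDerivAt.fun_sum fun l _ => ?_
    exact (h2s.fun_pow (j + 1 - 2 * l)).const_mul _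
  refine hsum.congr_deriv ?_
  -- drop the vanishing top term when `j` is odd, then compare term-wise
  have hdrop : ∑ l ∈ Finset.range ((j + 1) / 2 + 1), (-1 : ℝ) ^ l *
        (∏ i ∈ Finset.range (j + 1 - l), ((3 : ℝ) / 2 + (i : ℝ))) /
          (((l.factorial : ℕ) : ℝ) * (((j + 1 - 2 * l).factorial : ℕ) : ℝ)) *
        (((j + 1 - 2 * l : ℕ) : ℝ) * (2 * s) ^ (j + 1 - 2 * l - 1) * 2) =
      ∑ l ∈ Finset.range (j / 2 + 1), (-1 : ℝ) ^ l *
        (∏ i ∈ Finset.range (j + 1 - l), ((3 : ℝ) / 2 + (i : ℝ))) /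
          (((l.factorial : ℕ) : ℝ) * (((j + 1 - 2 * l).factorial : ℕ) : ℝ)) *
        (((j + 1 - 2 * l : ℕ) : ℝ) * (2 * s) ^ (j + 1 - 2 * l - 1) * 2) := by
    rcases Nat.even_or_odd j with ⟨m, hm⟩ | ⟨m, hm⟩
    · have h : (j + 1) / 2 = j / 2 := by omega
      rw [h]
    · have h1 : (j + 1) / 2 + 1 = (j / 2 + 1) + 1 := by omega
      have h0 : j + 1 - 2 * (j / 2 + 1) = 0 := by omega
      rw [h1, Finset.sum_range_succ, h0]
      simp
  rw [hdrop, gegenSix, Finset.mul_sum]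
  refine Finset.sum_congr rfl fun l hl => ?_
  have hl2 : 2 * l ≤ j := by
    have := Finset.mem_range.1 hl
    omega
  exact gegen_deriv_summand j l hl2 s

/-! ### The derivative of the zonal series -/

/-- `zonal τ s = 1 + ∑_{j} wt (j+1) τ · C_{j+1}(s)` (the `k = 0` mode is `1`). [folklore] -/
theorem zonal_eq_one_add_tsum {τ : ℝ} (hτ : 0 < τ) (s : ℝ) :
    zonal τ s = 1 + ∑' j : ℕ, wt (j + 1) τ * gegen (j + 1) s := by
  rw [zonal, (summable_wt_mul_gegen hτ s).tsum_eq_zero_add]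
  simp

/-- The term-wise derivative series sums to `5 e^{-4τ} · zonalSix τ s`. [folklore] -/
theorem tsum_wt_succ_mul_gegenSix (τ s : ℝ) :
    ∑' j : ℕ, wt (j + 1) τ * (3 * gegenSix j s) = 5 * Real.exp (-4 * τ) * zonalSix τ s := by
  rw [zonalSix, ← tsum_mul_left]
  refine tsum_congr fun j => ?_
  rw [← mul_assoc, wt_succ_mul_three]; ring

/-- **Term-wise differentiation of the zonal series**: for `τ > 0` and every real `s`,
`∂_s zonal τ s = 5 e^{-4τ} · zonalSix τ s`. [folklore] -/
theorem hasDerivAt_zonal {τ : ℝ} (hτ : 0 < τ) (s : ℝ) :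
    HasDerivAt (zonal τ) (5 * Real.exp (-4 * τ) * zonalSix τ s) s := by
  set R : ℝ := |s| + 1 with hR
  have hR1 : 1 ≤ R := by rw [hR]; linarith [abs_nonneg s]
  have hst : s ∈ Set.Ioo (-R) R := by
    rw [hR]; constructor <;> linarith [neg_abs_le s, le_abs_self s]
  have habs : ∀ y ∈ Set.Ioo (-R) R, |y| ≤ R := fun y hy => abs_le.2 ⟨hy.1.le, hy.2.le⟩
  have hD : HasDerivAt (fun z => ∑' j : ℕ, wt (j + 1) τ * gegen (j + 1) z)
      (∑' j : ℕ, wt (j + 1) τ * (3 * gegenSix j s)) s := by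
    refine hasDerivAt_tsum_of_isPreconnected (summable_majorant hτ (by positivity : (0:ℝ) ≤ 2 * R))
      isOpen_Ioo isPreconnected_Ioo (fun j y _ => (hasDerivAt_gegen_succ j y).const_mul _)
      (fun j y hy => norm_wt_succ_mul_gegenSix_le hτ hR1 (habs y hy) j) hst ?_ hst
    exact (summable_nat_add_iff (f := fun k => wt k τ * gegen k s) 1).2 (summable_wt_mul_gegen hτ s)
  have hfun : zonal τ = fun z => 1 + ∑' j : ℕ, wt (j + 1) τ * gegen (j + 1) z :=
    funext (zonal_eq_one_add_tsum hτ)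
  rw [hfun, ← tsum_wt_succ_mul_gegenSix]
  exact hD.const_add 1

/-- `zonal τ` is differentiable on `ℝ` for `τ > 0`. [folklore] -/
theorem differentiable_zonal {τ : ℝ} (hτ : 0 < τ) : Differentiable ℝ (zonal τ) :=
  fun s => (hasDerivAt_zonal hτ s).differentiableAt

/-- `zonal τ` is continuous on `ℝ` for `τ > 0`. [folklore] -/
theorem continuous_zonal {τ : ℝ} (hτ : 0 < τ) : Continuous (zonal τ) :=
  (differentiable_zonal hτ).continuous

/-- `deriv (zonal τ) s = 5 e^{-4τ} · zonalSix τ s`. [folklore] -/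
theorem deriv_zonal {τ : ℝ} (hτ : 0 < τ) (s : ℝ) :
    deriv (zonal τ) s = 5 * Real.exp (-4 * τ) * zonalSix τ s :=
  (hasDerivAt_zonal hτ s).deriv

/-- `zonalSix τ` is continuous on `ℝ` for `τ > 0` (locally uniform convergence). [folklore] -/
theorem continuous_zonalSix {τ : ℝ} (hτ : 0 < τ) : Continuous (zonalSix τ) := by
  refine continuous_iff_continuousAt.2 fun s => ?_
  set R : ℝ := |s| + 1 with hR
  have hR1 : 1 ≤ R := by rw [hR]; linarith [abs_nonneg s]
  have hst : s ∈ Set.Ioo (-R) R := by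
    rw [hR]; constructor <;> linarith [neg_abs_le s, le_abs_self s]
  have habs : ∀ y ∈ Set.Ioo (-R) R, |y| ≤ R := fun y hy => abs_le.2 ⟨hy.1.le, hy.2.le⟩
  have hcont : ContinuousOn (zonalSix τ) (Set.Ioo (-R) R) := by
    refine continuousOn_tsum (fun j => ?_) (summable_majorant hτ (by positivity : (0:ℝ) ≤ 2 * R))
      (fun j y hy => norm_wtSix_mul_gegenSix_le hτ hR1 (habs y hy) j)
    unfold gegenSix
    fun_prop
  exact hcont.continuousAt (isOpen_Ioo.mem_nhds hst)

/-! ### The reduction -/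

/-- **Reduction of the monotonicity of the `S⁴` kernel to the positivity of the `S⁶` kernel**: if
`zonalSix τ ≥ 0` on `[-1, 1]`, then `s ↦ zonal τ s` is monotone on `[-1, 1]` (the heat kernel of the
round `S⁴` is a non-increasing function of the geodesic distance `arccos s`). [folklore] -/
theorem monotoneOn_zonal_of_zonalSix_nonneg {τ : ℝ} (hτ : 0 < τ)
    (h : ∀ s ∈ Set.Icc (-1 : ℝ) 1, 0 ≤ zonalSix τ s) : MonotoneOn (zonal τ) (Set.Icc (-1) 1) := by
  refine monotoneOn_of_deriv_nonneg (convex_Icc _ _) (continuous_zonal hτ).continuousOn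
    (differentiable_zonal hτ).differentiableOn fun x hx => ?_
  rw [interior_Icc] at hx
  rw [deriv_zonal hτ]
  exact mul_nonneg (by positivity) (h x (Set.Ioo_subset_Icc_self hx))

end Literature.Geometry.Riemannian.SphericalZonalKernelSeries
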